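import Summits.SmoothPoincare4.SmoothPoincare4.Theses.SblfDescent
import Summits.SmoothPoincare4.SmoothPoincare4.Theorems.SblfDescentRungOne
import Summits.SmoothPoincare4.SmoothPoincare4.Theorems.SblfDescentSblfExists
import Summits.SmoothPoincare4.SmoothPoincare4.Theorems.SblfDescentSblfExistsShield
import Summits.SmoothPoincare4.SmoothPoincare4.Theorems.RungOne.Negative.OfSmoothPoincare4
import Summits.SmoothPoincare4.SmoothPoincare4.Theorems.StepGE3.Negative.OfSmoothPoincare4
import Literature.Topology.FourManifolds.SimplifiedBrokenLefschetzEulerCount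

/-!
# Crux `RungOne` — equivalence audit (crux-strategist `cstrat-stmt-SmoothPoincare4-18531-q1`, suspect = equivalence)

The gate flagged item `stmt-SmoothPoincare4-18531` (`SblfDescent.RungOne`) `summit_equivalent`
because of the landed refuter lemma
`Theorems.RungOne.Negative.rungOne_iff_smoothPoincare4_of_forall_sblf (hex) : RungOne ↔ SmoothPoincare4`,
whose side condition `hex` ("every smooth homotopy 4-sphere carries a genus-one SBLF",
`ForallSblfZero` below) is NOT an item of the route (`conditional_terms_unresolved` on the flag).

This file is kernel-checked bookkeeping deciding whether that equivalence is BENIGN.  It is: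

1. `rungOne_of_noLefschetzClassification` — `RungOne` holds outright modulo ONE published theorem,
   the named fact `B = nonempty_diffeomorph_sphere_four_of_sblf_genus_one_noLefschetz`
   (Baykur–Kamada 2015, Lemma 11 + Cor. 14; Hayano 2011, Thm. 4.2): the Euler count `A` is
   DISCHARGED in the tree (`card_eq_four_mul_of_sblf_of_homotopyEquiv_sphere_four_holds`) and
   `RungOne ⇐ A ∧ B` is `Theorems.RungOne_of_eulerCount_of_noLefschetz`.  So the crux is a theorem
   of mathematics, not a summit-strength statement.
2. `forallSblfZero_iff_smoothPoincare4` — the side condition `hex` of the flagged lemma is ITSELF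
   the summit, modulo the same `B`: `S → hex` unconditionally (transport of the tree's explicit
   Auroux–Donaldson–Katzarkov fibration of the round `S⁴`, `exists_sblf_zero_of_diffeomorph_sphere_four`),
   `hex → S` modulo `B`.  Hence "RungOne ↔ S given hex" is "RungOne ↔ S given S": no information on
   the strength of `RungOne`.
3. `rungOne_iff_summit_iff_summit` — modulo `B`, the flagged biconditional `RungOne ↔ S` is
   logically THE SUMMIT ITSELF.  Discharging the flag into "RungOne is summit-hard" would prove SPC4.
4. `forallSblfZero_of_siblings` / `siblings_of_smoothPoincare4` — "given the route's other cruxes":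
   `hex` follows from the three OPEN siblings `SblfExists`, `StepTwo`, `StepGE3` (descent to genus one,
   the route's own induction minus its bottom rung), and each of those is implied by `S`
   (`SblfExists` unconditionally; `StepTwo ∧ StepGE3` modulo Baykur 2012 Thm 18 + Lemma 12,
   `sblf_of_every_genus_of_diffeomorph_sphere_four`).  None of the three is proved; the only PROVED
   sibling is the `Assembly` (= `closes`, modus ponens by design).  This is the shape of a sound
   complete decomposition `S ⇐ (open, S-shielded descent) ∧ (known bottom rung)`, with the open
   content on the descent side, not on `RungOne`.

No new mathematics; composition of landed theorems.  Sorry-free.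
-/

noncomputable section

-- `Summit.SmoothPoincare4.SmoothPoincare4.…` (summit = sub-problem) trips `dupNamespace`.
set_option linter.dupNamespace false

open scoped Manifold ContDiff Topology ContinuousMap

namespace Summit.SmoothPoincare4.SmoothPoincare4.Cruxes.RungOne.EquivalenceAudit

open Literature.Topology.FourManifolds
open Summit.SmoothPoincare4.SmoothPoincare4.Theses.SblfDescent
open Summit.SmoothPoincare4.SmoothPoincare4.Theorems

/-- **The side condition of the flagged witness lemma** (`hex` of
`rungOne_iff_smoothPoincare4_of_forall_sblf`, verbatim): every smooth homotopy 4-sphere carries a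
simplified broken Lefschetz fibration of lower genus `0` (tree form). -/
def ForallSblfZero : Prop :=
  ∀ (M : Type) [TopologicalSpace M] [T2Space M] [SecondCountableTopology M]
    [ChartedSpace (EuclideanSpace ℝ (Fin 4)) M] [IsManifold (𝓡 4) ∞ M],
    M ≃ₕ Metric.sphere (0 : EuclideanSpace ℝ (Fin 5)) 1 →
      ∃ (o : SmoothOrientation (𝓡 4) M) (f : M → Metric.sphere (0 : EuclideanSpace ℝ (Fin 3)) 1)
        (L : Finset M), IsSimplifiedBrokenLefschetzFibration o f L 0

/-! ### (1) The crux is a theorem modulo one published fact -/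

/-- **`RungOne` modulo `B` alone.**  The Euler count `A` is discharged in the tree, so the
two-fact staging `RungOne_of_eulerCount_of_noLefschetz` needs only the Lefschetz-free genus-one
classification `B` (Baykur–Kamada 2015, Lemma 11 + Cor. 14). [cite: BaykurKamada2015, Lemma 11 and Cor. 14] -/
theorem rungOne_of_noLefschetzClassification
    (hB : nonempty_diffeomorph_sphere_four_of_sblf_genus_one_noLefschetz) :
    Summit.SmoothPoincare4.SmoothPoincare4.Theses.SblfDescent.RungOne :=
  RungOne_of_eulerCount_of_noLefschetz card_eq_four_mul_of_sblf_of_homotopyEquiv_sphere_four_holds hB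

/-! ### (2) The side condition of the flagged lemma is the summit (modulo `B`) -/

/-- **`SmoothPoincare4 → ForallSblfZero`, unconditionally**: under the summit a homotopy 4-sphere is
diffeomorphic to `S⁴` and carries the transported ADK fibration (`L = ∅`). [folklore] -/
theorem forallSblfZero_of_smoothPoincare4 (hS : _root_.SmoothPoincare4) : ForallSblfZero := by
  intro M _ _ _ _ _ e
  obtain ⟨Φ⟩ := hS M ‹_› ‹_› e
  obtain ⟨o, f, hf⟩ := exists_sblf_zero_of_diffeomorph_sphere_four M Φ
  exact ⟨o, f, ∅, hf⟩

/-- **`ForallSblfZero → SmoothPoincare4`, modulo `B`**: this is the `→` direction of the flagged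
lemma fed with (1). [cite: BaykurKamada2015, Lemma 11 and Cor. 14] -/
theorem smoothPoincare4_of_forallSblfZero
    (hB : nonempty_diffeomorph_sphere_four_of_sblf_genus_one_noLefschetz) (hex : ForallSblfZero) :
    _root_.SmoothPoincare4 :=
  (Summit.SmoothPoincare4.SmoothPoincare4.Theorems.RungOne.Negative.rungOne_iff_smoothPoincare4_of_forall_sblf
      hex).mp (rungOne_of_noLefschetzClassification hB)

/-- **The side condition IS the summit, modulo `B`.** [cite: BaykurKamada2015, Lemma 11 and Cor. 14] -/
theorem forallSblfZero_iff_smoothPoincare4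
    (hB : nonempty_diffeomorph_sphere_four_of_sblf_genus_one_noLefschetz) :
    ForallSblfZero ↔ _root_.SmoothPoincare4 :=
  ⟨smoothPoincare4_of_forallSblfZero hB, forallSblfZero_of_smoothPoincare4⟩

/-! ### (3) The benign reading of the flag -/

/-- **Modulo `B`, the flagged biconditional `RungOne ↔ SmoothPoincare4` is the summit itself.**
So the flag cannot be discharged into "RungOne is summit-strength" short of proving SPC4; with `B`
a published theorem, `RungOne` sits strictly on the known side. [folklore] -/
theorem rungOne_iff_summit_iff_summit
    (hB : nonempty_diffeomorph_sphere_four_of_sblf_genus_one_noLefschetz) :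
    (Summit.SmoothPoincare4.SmoothPoincare4.Theses.SblfDescent.RungOne ↔ _root_.SmoothPoincare4) ↔
      _root_.SmoothPoincare4 :=
  ⟨fun h => h.mp (rungOne_of_noLefschetzClassification hB),
    fun hS => ⟨fun _ => hS, fun _ => rungOne_of_noLefschetzClassification hB⟩⟩

/-- **The flagged lemma restated with its side condition made explicit as a conjunct**: modulo `B`,
`ForallSblfZero ∧ RungOne ↔ SmoothPoincare4` — and the conjunct carrying the summit is
`ForallSblfZero`, since `RungOne` is discharged by `B`. [folklore] -/
theorem forallSblfZero_and_rungOne_iff_smoothPoincare4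
    (hB : nonempty_diffeomorph_sphere_four_of_sblf_genus_one_noLefschetz) :
    (ForallSblfZero ∧ Summit.SmoothPoincare4.SmoothPoincare4.Theses.SblfDescent.RungOne) ↔
      _root_.SmoothPoincare4 :=
  ⟨fun h => smoothPoincare4_of_forallSblfZero hB h.1,
    fun hS => ⟨forallSblfZero_of_smoothPoincare4 hS, rungOne_of_noLefschetzClassification hB⟩⟩

/-! ### (4) "Given the route's other cruxes": the side condition comes from three OPEN items -/

/-- **`SblfExists → StepTwo → StepGE3 → ForallSblfZero`**: the route's own ℕ-induction on the lower
genus with its bottom rung removed — the three OPEN siblings of `RungOne` descend any SBLF of a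
homotopy 4-sphere to lower genus `0`.  So the flag's "given the other cruxes" means: given two
SPC4-shielded open cruxes and the (XL, unproved in tree) Baykur–Saeki existence support. [folklore] -/
theorem forallSblfZero_of_siblings
    (hex : Summit.SmoothPoincare4.SmoothPoincare4.Theses.SblfDescent.SblfExists)
    (h2 : Summit.SmoothPoincare4.SmoothPoincare4.Theses.SblfDescent.StepTwo)
    (h3 : Summit.SmoothPoincare4.SmoothPoincare4.Theses.SblfDescent.StepGE3) : ForallSblfZero := by
  have H2 := Summit.SmoothPoincare4.SmoothPoincare4.Theorems.StepGE3.Negative.stepTwo_iff_tree.mp h2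
  have H3 := Summit.SmoothPoincare4.SmoothPoincare4.Theorems.StepGE3.Negative.stepGE3_iff_tree.mp h3
  have HX := sblfExists_iff.mp hex
  intro M _ _ _ _ _ e
  have key : ∀ h : ℕ,
      (∃ (o : SmoothOrientation (𝓡 4) M) (f : M → Metric.sphere (0 : EuclideanSpace ℝ (Fin 3)) 1)
        (L : Finset M), IsSimplifiedBrokenLefschetzFibration o f L h) →
      ∃ (o : SmoothOrientation (𝓡 4) M) (f : M → Metric.sphere (0 : EuclideanSpace ℝ (Fin 3)) 1)
        (L : Finset M), IsSimplifiedBrokenLefschetzFibration o f L 0 := by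
    intro h
    induction h with
    | zero => exact id
    | succ h ih =>
      intro hh
      cases h with
      | zero => exact H2 M e hh
      | succ h => exact ih (H3 M e (h + 1) (Nat.succ_le_succ (Nat.zero_le h)) hh)
  obtain ⟨o, f, L, h, hf⟩ := HX M e
  exact key h ⟨o, f, L, hf⟩

/-- **Conversely every sibling is implied by the summit**: `SblfExists` unconditionally
(`sblfExists_of_smoothPoincare4`), `StepTwo ∧ StepGE3` modulo Baykur's every-genus fact
(`StepGE3.Negative.descent_of_smoothPoincare4`).  Together with (2) and the flagged lemma, ALL FOUR
open-or-known items of the route are squeezed between `S` and `S`-modulo-print-facts — the normal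
form of a complete decomposition of a conjecture into shielded pieces. [cite: Baykur2012, Thm. 18 and Lemma 12] -/
theorem siblings_of_smoothPoincare4 (H : sblf_of_every_genus_of_diffeomorph_sphere_four)
    (hS : _root_.SmoothPoincare4) :
    Summit.SmoothPoincare4.SmoothPoincare4.Theses.SblfDescent.SblfExists ∧
      Summit.SmoothPoincare4.SmoothPoincare4.Theses.SblfDescent.StepTwo ∧
      Summit.SmoothPoincare4.SmoothPoincare4.Theses.SblfDescent.StepGE3 :=
  ⟨sblfExists_of_smoothPoincare4 hS,
    Summit.SmoothPoincare4.SmoothPoincare4.Theorems.StepGE3.Negative.descent_of_smoothPoincare4 H hS⟩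

/-- **The side condition from the siblings, and back to the summit**: modulo `B`, the conjunction of
the three OPEN siblings already gives SPC4 WITHOUT the item `RungOne` as a hypothesis (because `B`
discharges it) — i.e. the open content of the route is entirely on the descent side.
[cite: BaykurKamada2015, Lemma 11 and Cor. 14] -/
theorem smoothPoincare4_of_siblings
    (hB : nonempty_diffeomorph_sphere_four_of_sblf_genus_one_noLefschetz)
    (hex : Summit.SmoothPoincare4.SmoothPoincare4.Theses.SblfDescent.SblfExists)
    (h2 : Summit.SmoothPoincare4.SmoothPoincare4.Theses.SblfDescent.StepTwo)
    (h3 : Summit.SmoothPoincare4.SmoothPoincare4.Theses.SblfDescent.StepGE3) :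
    _root_.SmoothPoincare4 :=
  smoothPoincare4_of_forallSblfZero hB (forallSblfZero_of_siblings hex h2 h3)

end Summit.SmoothPoincare4.SmoothPoincare4.Cruxes.RungOne.EquivalenceAudit

end
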